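import Summits.AnomalousDissipation.AnomalousDissipation.Theses.EulerLimit
import Summits.AnomalousDissipation.AnomalousDissipation.Cruxes.EulerlimitThesisV2.Lines.tight
import Literature.Analysis.FunctionSpaces.TorusSpaceTimeL3Cauchy
import Literature.Analysis.FunctionSpaces.TorusMollifiedFieldFourierBounds
import Literature.Analysis.FunctionSpaces.TorusMollifierEstimates
import Literature.Analysis.FluidPDE.ClassicalNSFourierModes
import Literature.Analysis.FluidPDE.LongTimeAverageSlidingWindow
import Literature.Analysis.FluidPDE.BallAverageLimits

/-!
# STUB-PLAN sketch (stub-critic) — `stub_loudTightFamily`, line `tight`, crux `EulerLimit.EulerlimitThesisV2`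
(stmt-AnomalousDissipation-0511)

Elaboration-only companion of `STUB-PLAN-stub_loudTightFamily.md`: the MERGED, RANKED helper list.
Every `sorry` is a helper lemma for the stub prover; nothing here is registered; the skeleton is
untouched.  `LoudTightFamily` is the registered stub's statement BY VALUE (checked `Iff.rfl`
against `Tight.Statement.stub_loudTightFamily` at the end); `LoudSpaceTightFamily` is the residual
heart `R` the plan recommends registering.
-/

set_option linter.dupNamespace false
set_option linter.unusedVariables false

noncomputable section

open Filter Set MeasureTheory Function UnitAddTorus
open scoped ENNReal NNReal Convolution Topology

namespace Summit.AnomalousDissipation.AnomalousDissipation.Cruxes.EulerlimitThesisV2.Tight.Plan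

open Literature.Analysis.FunctionSpaces Literature.Analysis.FunctionSpaces.Torus

/-- The physical flat unit torus `𝕋³` (local notation, as in the skeleton). -/
local notation "𝕋³" => UnitAddTorus (Fin 3)
/-- Velocity values (local notation, as in the skeleton). -/
local notation "E³" => EuclideanSpace ℝ (Fin 3)

/-! ## §0 The stub by value and the residual heart `R` -/

/-- `H` = the registered stub `stub_loudTightFamily`, verbatim. -/
def LoudTightFamily : Prop :=
  ∃ f : 𝕋³ → E³, Torus.IsSmooth f ∧ Torus.IsDivFree f ∧ Torus.HasZeroMean f ∧
    ∃ (τ c E M : ℝ), 0 < τ ∧ 0 < c ∧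
      ∃ (ν : ℕ → ℝ) (us : ℕ → ℝ → 𝕋³ → E³) (ps : ℕ → ℝ → 𝕋³ → ℝ),
        (∀ j, 0 < ν j) ∧ Filter.Tendsto ν Filter.atTop (nhds 0) ∧
        (∀ j, IsClassicalNSSolutionOn Set.univ (ν j) (fun _ => f) (us j) (ps j) ∧
          Function.Periodic (us j) τ) ∧
        (∀ j t, ∫ x, ‖us j t x‖ ^ 2 ≤ E) ∧
        (∀ j, ∫⁻ t in Set.Ioo 0 τ, ∫⁻ x, ‖us j t x‖ₑ ^ 3 ≤ ENNReal.ofReal M) ∧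
        (∀ j, c ≤ ∫ t in (0 : ℝ)..τ, MeasureTheory.integral MeasureTheory.volume
            (fun x => inner ℝ (f x) (us j t x))) ∧
        (∀ ε : ℝ, 0 < ε → ∃ δ : ℝ, 0 < δ ∧ ∀ (j : ℕ) (s : ℝ) (h : 𝕋³), |s| ≤ δ → ‖h‖ ≤ δ →
            ∫⁻ t in Set.Ioo 0 τ, ∫⁻ x, ‖us j (t + s) (x + h) - us j t x‖ₑ ^ 3 ≤ ENNReal.ofReal ε)

/-- **`R` = `LoudSpaceTightFamily` (the residual heart to REGISTER as `stub_loudSpaceTightFamily`).**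
Verbatim `H` with the `L³`-mass clause DELETED and the modulus clause SPACE-ONLY (`s = 0`):
"one steady smooth force drives, for `ν_j → 0`, `τ`-periodic classical flows with bounded energy,
period input `≥ c > 0`, and uniformly small absolute third-order structure function
`sup_j ∫₀^τ‖δ_h u_j‖³_{L³} → 0` as `h → 0`". `H → R` is the slice `s = 0`; the plan proves `R → H`. -/
def LoudSpaceTightFamily : Prop :=
  ∃ f : 𝕋³ → E³, Torus.IsSmooth f ∧ Torus.IsDivFree f ∧ Torus.HasZeroMean f ∧
    ∃ (τ c E : ℝ), 0 < τ ∧ 0 < c ∧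
      ∃ (ν : ℕ → ℝ) (us : ℕ → ℝ → 𝕋³ → E³) (ps : ℕ → ℝ → 𝕋³ → ℝ),
        (∀ j, 0 < ν j) ∧ Filter.Tendsto ν Filter.atTop (nhds 0) ∧
        (∀ j, IsClassicalNSSolutionOn Set.univ (ν j) (fun _ => f) (us j) (ps j) ∧
          Function.Periodic (us j) τ) ∧
        (∀ j t, ∫ x, ‖us j t x‖ ^ 2 ≤ E) ∧
        (∀ j, c ≤ ∫ t in (0 : ℝ)..τ, MeasureTheory.integral MeasureTheory.volume
            (fun x => inner ℝ (f x) (us j t x))) ∧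
        (∀ ε : ℝ, 0 < ε → ∃ δ : ℝ, 0 < δ ∧ ∀ (j : ℕ) (h : 𝕋³), ‖h‖ ≤ δ →
            ∫⁻ t in Set.Ioo 0 τ, ∫⁻ x, ‖us j t (x + h) - us j t x‖ₑ ^ 3 ≤ ENNReal.ofReal ε)

/-! ## §1 PLAN 1 (TOP) — the reduction `R → H`: six helpers + assembly -/

/-- **L0 (S).** Period windows of a `τ`-periodic `ℝ≥0∞`-valued function may be shifted
(`Literature.Analysis.FluidPDE.setLIntegral_Ioo_add_right` + `Ioo`/`Ioc` a.e. +
`AddCircle.lintegral_preimage`, cf. `lintegral_Ioc_eq_of_periodic`). -/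
theorem setLIntegral_Ioo_comp_add_of_periodic {g : ℝ → ℝ≥0∞} {τ : ℝ} (hτ : 0 < τ)
    (hg : Function.Periodic g τ) (s : ℝ) :
    ∫⁻ t in Ioo 0 τ, g (t + s) = ∫⁻ t in Ioo 0 τ, g t := by
  sorry

/-- **L1 (S).** Same-force mode-Lipschitz bound: corollary of the PROVED forced tree theorem
`Torus.IsClassicalNSSolutionOn.norm_mFourierCoeff_sub_le` (`S = univ`), the integrand bounded by
constants via `∫‖u‖² ≤ E`, `∫‖u‖ ≤ √E` (probability space) and the steady force. -/
theorem modeLipschitz {ν E νmax : ℝ} {f : 𝕋³ → E³} {u : ℝ → 𝕋³ → E³} {p : ℝ → 𝕋³ → ℝ}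
    (h : IsClassicalNSSolutionOn Set.univ ν (fun _ => f) u p) (hν : |ν| ≤ νmax)
    (hE : ∀ t, ∫ x, ‖u t x‖ ^ 2 ≤ E) (k : Fin 3 → ℤ) (s t : ℝ) :
    ‖mFourierCoeff (EuclideanSpace.complexify ∘ u t) k -
        mFourierCoeff (EuclideanSpace.complexify ∘ u s) k‖ ≤
      |t - s| * (3 * (2 * Real.pi * Real.sqrt (freqNormSq k)) * E +
        νmax * (4 * Real.pi ^ 2 * freqNormSq k) * Real.sqrt E + ∫ x, ‖f x‖) := by
  sorry

/-- **L2 (M).** Slab CET (6): if the spatial SLAB modulus at scale `ε` is `≤ A`, so is the slab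
mollification error (`kernel_convolution_sub_self_apply` pointwise, then Minkowski–Jensen
`lintegral_rpow_enorm_integral_smul_le` on `X = (0,τ) × 𝕋³` via `lintegral_prod`, kernel mass one
`lintegral_enorm_kernel`, support `support_kernel_subset`).  SHARED with stub 2's plan (its H4). -/
theorem slab_kernel_convolution_sub_self_le {τ : ℝ} {w : ℝ → 𝕋³ → E³}
    (hw : IsSmoothSpaceTimeOn Set.univ w) {ε : ℝ} (hε : 0 < ε) (hε' : ε ≤ 1 / 4) {A : ℝ≥0∞}
    (hA : ∀ h : 𝕋³, ‖h‖ ≤ ε → ∫⁻ t in Ioo 0 τ, ∫⁻ x, ‖w t (x + h) - w t x‖ₑ ^ 3 ≤ A) :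
    ∫⁻ t in Ioo 0 τ, ∫⁻ x, ‖(kernel ε ⋆ w t) x - w t x‖ₑ ^ 3 ≤ A := by
  sorry

/-- **L3 (S–M).** The `L³`-mass clause is REDUNDANT: energy `≤ E` + the spatial slab modulus at ONE
scale `δ ≤ 1/4` (tolerance `1`) bound the slab mass, uniformly (Minkowski `rpow_lintegral_add_le`:
`u = (u − ρ_δ⋆u) + ρ_δ⋆u`; first `≤ 1` by L2; second pointwise
`‖ρ_δ⋆u(t)‖_∞ ≤ (∫‖u(t)‖)(1 + ∑ₖ|ρ̂_δ(k)|) ≤ C_δ √E` by `norm_kernel_convolution_apply_le` with `K = 0`). -/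
theorem slabMass_le_of_energy_of_spaceModulus {τ E δ : ℝ} (hτ : 0 < τ) (hδ : 0 < δ) (hδ' : δ ≤ 1 / 4) :
    ∃ M : ℝ, ∀ w : ℝ → 𝕋³ → E³, IsSmoothSpaceTimeOn Set.univ w →
      (∀ t, ∫ x, ‖w t x‖ ^ 2 ≤ E) →
      (∀ h : 𝕋³, ‖h‖ ≤ δ → ∫⁻ t in Ioo 0 τ, ∫⁻ x, ‖w t (x + h) - w t x‖ₑ ^ 3 ≤ 1) →
      ∫⁻ t in Ioo 0 τ, ∫⁻ x, ‖w t x‖ₑ ^ 3 ≤ ENNReal.ofReal M := by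
  sorry

/-- **L4 (M–L; LOAD-BEARING).** TIME modulus from SPACE modulus + the equation, uniformly in the
family: clone of the PROVED 420-line template `Torus.exists_forall_lintegral_sub_pow_three_le_of_modes`
with `(w n, w m) ↦ (u_j(·+s), u_j)`:
`u(·+s) − u = [u(·+s) − ρ_ε⋆u(·+s)] + ρ_ε⋆[u(·+s) − u] + [ρ_ε⋆u − u]`; outer terms `≤ A(ε)^{1/3}`
in `L³(slab)` by L2 (+ L0 for the shifted window); middle term POINTWISE
`≤ |s|·∑_{|k|≤K} L_k + 2√E·τ_K(ε)` (`norm_kernel_convolution_apply_le`, L1,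
`tendsto_tsum_compl_norm_mFourierCoeff_kernel`); choose `ε`, then `K`, then `δ`. -/
theorem timeModulus_of_spaceModulus {f : 𝕋³ → E³} {τ E νmax : ℝ} (hτ : 0 < τ)
    {ν : ℕ → ℝ} {us : ℕ → ℝ → 𝕋³ → E³} {ps : ℕ → ℝ → 𝕋³ → ℝ}
    (hν : ∀ j, |ν j| ≤ νmax)
    (hcl : ∀ j, IsClassicalNSSolutionOn Set.univ (ν j) (fun _ => f) (us j) (ps j))
    (hper : ∀ j, Function.Periodic (us j) τ)
    (hE : ∀ j t, ∫ x, ‖us j t x‖ ^ 2 ≤ E)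
    (hspace : ∀ ε : ℝ, 0 < ε → ∃ δ : ℝ, 0 < δ ∧ ∀ (j : ℕ) (h : 𝕋³), ‖h‖ ≤ δ →
      ∫⁻ t in Ioo 0 τ, ∫⁻ x, ‖us j t (x + h) - us j t x‖ₑ ^ 3 ≤ ENNReal.ofReal ε)
    {ε : ℝ} (hε : 0 < ε) :
    ∃ δ : ℝ, 0 < δ ∧ ∀ (j : ℕ) (s : ℝ), |s| ≤ δ →
      ∫⁻ t in Ioo 0 τ, ∫⁻ x, ‖us j (t + s) x - us j t x‖ₑ ^ 3 ≤ ENNReal.ofReal ε := by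
  sorry

/-- **L5 (M; the assembly `R → H`, to be REGISTERED as `stub_loudTightOfSpaceTight`).**
`M` from L3 (modulus at tolerance `1`, scale `min δ₁ (1/4)`); `νmax` from `ν_j → 0`;
`u(t+s,x+h) − u(t,x) = δ_h u(t+s,·)(x) + [u(t+s,x) − u(t,x)]`: L0 on the first (periodicity), L4
on the second, Minkowski `rpow_lintegral_add_le` with each piece `≤ ε/8` (`2·(ε/8)^{1/3} = ε^{1/3}`). -/
theorem loudTight_of_loudSpaceTight : LoudSpaceTightFamily → LoudTightFamily := by
  sorry

/-! ## §2 PLAN 2 (cross-route edge, optional) — the steady extreme: `SteadyL3Realisation → R` -/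

/-- `H_C`: steady classical states of `NS(ν_j, f)`, `ν_j → 0⁺`, converging in `L³(𝕋³)` to a field
of positive input (= route SteadyWeakLimit's `SteadyWeakRealisation`, stmt-1303, with weak-`L²`
upgraded to strong-`L³`). -/
def SteadyL3Realisation : Prop :=
  ∃ f : 𝕋³ → E³, Torus.IsSmooth f ∧ Torus.IsDivFree f ∧ Torus.HasZeroMean f ∧
    ∃ (ν : ℕ → ℝ) (u : ℕ → 𝕋³ → E³) (p : ℕ → 𝕋³ → ℝ) (v : 𝕋³ → E³),
      (∀ j, 0 < ν j) ∧ Filter.Tendsto ν Filter.atTop (nhds 0) ∧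
      (∀ j, IsClassicalNSSolutionOn Set.univ (ν j) (fun _ => f) (fun _ => u j) (fun _ => p j)) ∧
      MemLp v 3 volume ∧
      Filter.Tendsto (fun j => ∫⁻ x, ‖u j x - v x‖ₑ ^ 3) Filter.atTop (nhds 0) ∧
      0 < ∫ x, inner ℝ (f x) (v x)

/-- **P2a (S–M).** Kolmogorov–Riesz NECESSITY on `𝕋³`: an `L³`-convergent sequence of smooth fields
is uniformly `L³`-translation-equicontinuous (`Literature.Analysis.FluidPDE.tendsto_lintegral_comp_add_sub`
for `v` and for each `u_j`, `j < N`; tail `‖τ_h u_j − u_j‖₃ ≤ 2‖u_j − v‖₃ + ‖τ_h v − v‖₃`). -/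
theorem uniformModulus_of_tendsto_L3 {u : ℕ → 𝕋³ → E³} {v : 𝕋³ → E³}
    (hu : ∀ j, Torus.IsSmooth (u j)) (hv : MemLp v 3 volume)
    (hlim : Filter.Tendsto (fun j => ∫⁻ x, ‖u j x - v x‖ₑ ^ 3) Filter.atTop (nhds 0))
    {ε : ℝ} (hε : 0 < ε) :
    ∃ δ : ℝ, 0 < δ ∧ ∀ (j : ℕ) (h : 𝕋³), ‖h‖ ≤ δ →
      ∫⁻ x, ‖u j (x + h) - u j x‖ₑ ^ 3 ≤ ENNReal.ofReal ε := by
  sorry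

/-- **P2b (S).** Input convergence and eventual floor: `|∫⟪f,u_j − v⟫| ≤ ‖f‖_∞‖u_j − v‖₁ ≤ ‖f‖_∞‖u_j − v‖₃`. -/
theorem eventually_input_ge_half {f : 𝕋³ → E³} (hf : Torus.IsSmooth f) {u : ℕ → 𝕋³ → E³}
    {v : 𝕋³ → E³} (hu : ∀ j, Torus.IsSmooth (u j)) (hv : MemLp v 3 volume)
    (hlim : Filter.Tendsto (fun j => ∫⁻ x, ‖u j x - v x‖ₑ ^ 3) Filter.atTop (nhds 0)) :
    ∀ᶠ j in Filter.atTop, (∫ x, inner ℝ (f x) (v x)) / 2 ≤ ∫ x, inner ℝ (f x) (u j x) := by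
  sorry

/-- **P2c (S–M; assembly).** Reindex past the floor index; `τ := 1`; slab integrals of time-constant
integrands are the constants (`setLIntegral_const`, `Real.volume_Ioo`, `intervalIntegral.integral_const`);
energy from bounded `L³` norms; the space modulus is P2a (no time part). -/
theorem loudSpaceTight_of_steadyL3 : SteadyL3Realisation → LoudSpaceTightFamily := by
  sorry

/-! ## §3 PLAN 3 (optional strengthening) — two-range reduction `LoudTwoRangeFamily → R`
(Drivas–Nguyen 2019 Lemma 1 on `𝕋³`): only the inertial-range `S₂` bound is physics. -/

/-- `H_B`: loud periodic classical family + uniform `L⁴(slab)` bound + `S₂(h) ≤ C‖h‖^ζ` for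
`ν_j ≤ ‖h‖^{2−ζ}` only. -/
def LoudTwoRangeFamily : Prop :=
  ∃ f : 𝕋³ → E³, Torus.IsSmooth f ∧ Torus.IsDivFree f ∧ Torus.HasZeroMean f ∧
    ∃ (τ c E M₄ C ζ : ℝ), 0 < τ ∧ 0 < c ∧ 0 < ζ ∧ ζ < 2 ∧
      ∃ (ν : ℕ → ℝ) (us : ℕ → ℝ → 𝕋³ → E³) (ps : ℕ → ℝ → 𝕋³ → ℝ),
        (∀ j, 0 < ν j) ∧ Filter.Tendsto ν Filter.atTop (nhds 0) ∧
        (∀ j, IsClassicalNSSolutionOn Set.univ (ν j) (fun _ => f) (us j) (ps j) ∧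
          Function.Periodic (us j) τ) ∧
        (∀ j t, ∫ x, ‖us j t x‖ ^ 2 ≤ E) ∧
        (∀ j, ∫⁻ t in Set.Ioo 0 τ, ∫⁻ x, ‖us j t x‖ₑ ^ 4 ≤ ENNReal.ofReal M₄) ∧
        (∀ j, c ≤ ∫ t in (0 : ℝ)..τ, MeasureTheory.integral MeasureTheory.volume
            (fun x => inner ℝ (f x) (us j t x))) ∧
        (∀ (j : ℕ) (h : 𝕋³), ν j ≤ ‖h‖ ^ (2 - ζ) →
            ∫⁻ t in Set.Ioo 0 τ, ∫⁻ x, ‖us j t (x + h) - us j t x‖ₑ ^ 2 ≤ ENNReal.ofReal (C * ‖h‖ ^ ζ))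

/-- **P3a (S–M).** Dissipation-range `L²` modulus of a smooth slice:
`∫‖w(x+h) − w(x)‖² ≤ 3‖h‖² ‖∇w‖²₂` (sup norm on `𝕋³`; mean value along `θ ↦ x + θh` + Jensen). -/
theorem lintegral_translate_sub_sq_le_gradNormSq {w : 𝕋³ → E³} (hw : Torus.IsSmooth w) (h : 𝕋³) :
    ∫⁻ x, ‖w (x + h) - w x‖ₑ ^ 2 ≤ ENNReal.ofReal (3 * ‖h‖ ^ 2 * gradNormSq w) := by
  sorry

/-- **P3b (S; SHARED TOOL — also the budget of Plan 4).** The period dissipation of a `τ`-periodic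
classical solution is paid by the input: `ν∫₀^τ‖∇u‖² = ∫₀^τ∫⟪f,u⟫ ≤ τ‖f‖₂√E`
(`IsClassicalNSSolutionOn.energy_balance_holds` + periodicity + Cauchy–Schwarz; conjunct (1) of route
item `PeriodAverageBalanceV2`, stmt-0513). -/
theorem period_dissipation_le {ν τ E : ℝ} {f : 𝕋³ → E³} {u : ℝ → 𝕋³ → E³} {p : ℝ → 𝕋³ → ℝ}
    (hτ : 0 < τ) (hf : Torus.IsSmooth f) (h : IsClassicalNSSolutionOn Set.univ ν (fun _ => f) u p)
    (hper : Function.Periodic u τ) (hE : ∀ t, ∫ x, ‖u t x‖ ^ 2 ≤ E) :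
    ν * ∫ t in (0 : ℝ)..τ, gradNormSq (u t) ≤ τ * Real.sqrt (∫ x, ‖f x‖ ^ 2) * Real.sqrt E := by
  sorry

/-- **P3c (S).** Cauchy–Schwarz lift `L² × L⁴ → L³` on the slab. -/
theorem slab_lintegral_pow_three_le {τ : ℝ} {g : ℝ → 𝕋³ → E³} (hg : IsSmoothSpaceTimeOn Set.univ g) :
    ∫⁻ t in Ioo 0 τ, ∫⁻ x, ‖g t x‖ₑ ^ 3 ≤
      (∫⁻ t in Ioo 0 τ, ∫⁻ x, ‖g t x‖ₑ ^ 2) ^ ((1 : ℝ) / 2) *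
        (∫⁻ t in Ioo 0 τ, ∫⁻ x, ‖g t x‖ₑ ^ 4) ^ ((1 : ℝ) / 2) := by
  sorry

/-- **P3d (M; assembly `H_B → R`).** Per `(j,h)`: inertial (hypothesis) or dissipative (P3a + P3b:
`S₂ ≤ 3‖h‖²τ‖f‖₂√E/ν_j ≤ 3τ‖f‖₂√E‖h‖^ζ`); increment `L⁴` bound `16M₄`; P3c. -/
theorem loudSpaceTight_of_loudTwoRange : LoudTwoRangeFamily → LoudSpaceTightFamily := by
  sorry

/-! ## §4 Checks: by-value copy = registered stub; every plan concludes the stub BY NAME -/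

example : LoudTightFamily ↔
    _root_.Summit.AnomalousDissipation.AnomalousDissipation.Cruxes.EulerlimitThesisV2.Tight.Statement.stub_loudTightFamily :=
  Iff.rfl

/-- `H → R` is the slice `s = 0` (so `R ⟺ H`: the reduction loses nothing). -/
theorem loudSpaceTight_of_loudTight : LoudTightFamily → LoudSpaceTightFamily := by
  rintro ⟨f, hf, hdf, hmf, τ, c, E, M, hτ, hc, ν, us, ps, hν, hν0, hcl, hE, hM, hin, heq⟩
  refine ⟨f, hf, hdf, hmf, τ, c, E, hτ, hc, ν, us, ps, hν, hν0, hcl, hE, hin, fun ε hε => ?_⟩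
  obtain ⟨δ, hδ, hδ'⟩ := heq ε hε
  refine ⟨δ, hδ, fun j h hh => ?_⟩
  simpa using hδ' j 0 h (by simpa using hδ.le) hh

example (hR : LoudSpaceTightFamily) :
    _root_.Summit.AnomalousDissipation.AnomalousDissipation.Cruxes.EulerlimitThesisV2.Tight.Statement.stub_loudTightFamily :=
  loudTight_of_loudSpaceTight hR

example (hC : SteadyL3Realisation) :
    _root_.Summit.AnomalousDissipation.AnomalousDissipation.Cruxes.EulerlimitThesisV2.Tight.Statement.stub_loudTightFamily :=
  loudTight_of_loudSpaceTight (loudSpaceTight_of_steadyL3 hC)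

example (hB : LoudTwoRangeFamily) :
    _root_.Summit.AnomalousDissipation.AnomalousDissipation.Cruxes.EulerlimitThesisV2.Tight.Statement.stub_loudTightFamily :=
  loudTight_of_loudSpaceTight (loudSpaceTight_of_loudTwoRange hB)

end Summit.AnomalousDissipation.AnomalousDissipation.Cruxes.EulerlimitThesisV2.Tight.Plan

end
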